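import Literature.Computability.Cryptography.RegevBDDToLWEIdealised
import Literature.Computability.Cryptography.PeikertReduction
import HarnessLib

/-!
# Peikert 2009, Prop. 3.2 on an admissible instance: the idealised `BDD → LWE` reduction succeeds on every `f`-admissible input

Topic `Computability/Cryptography` (family `pqc`), grouping namespace `Peikert2009`; the bridge between
`RegevBDDToLWEIdealised.lean` (Regev's Lemma 3.4 as one `PMF` experiment `Regev2009.regevBDD` over an
abstract pair of dual `ℤ`-bases, with its failure bound) and the vocabulary of `PeikertReduction.lean`
(inputs `((B, x), r)` coded as `GapCVPInstance`, admissibility `Peikert2009.BDDAdmissible q α f`, success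
`CVP.IsSolution (fun _ => 1)`), i.e. of the hypothesis `h₂` of
`peikert_gapSVPZeta_to_lwe_classical_of_components` (named fact
`Literature.Computability.Cryptography.peikert_gapSVPZeta_to_lwe_classical`, pqc.S20). Everything here is
PROVED; the definitions (`zBasis`, `dualZBasis`, `coeffVec`) have bodies; no named fact.

For a nonsingular instance `B ∈ ℤⁿˣⁿ` the rows form a `ℤ`-basis `zBasis` of `L(B)`, the dual basis
`B^∨` a `ℤ`-basis `dualZBasis` of `L(B)*` with `⟪bᵢ, b^∨ⱼ⟫ = δᵢⱼ` (`inner_zBasis_dualZBasis`); a target has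
a closest lattice vector (`exists_closest`), and `BDDAdmissible q α f ((B, x), r)` delivers every
hypothesis of `Regev2009.toReal_regevBDD_ne_le` at `ε = 2⁻ⁿ`: `√2·q·η_{2⁻ⁿ}(L(B)*) ≤ r` verbatim,
`r·‖x - κ‖ ≤ (α/√2)·q` from `dist(x, L(B)) ≤ αq/(√2 r)`, and the one-digit Babai condition
`‖x - κ‖/q < ‖b̃ᵢ‖/2` from `f(n)√(log n) ≤ r‖b̃ᵢ‖` as soon as `√2·α < f(n)√(log n)` (true eventually, since
`f → ∞`). Hence (`toReal_regevBDD_ne_le_of_admissible`): on every `f`-admissible input of dimension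
`n ≥ 1`, for every lattice sampler `D` within `δ` of `D_{L(B)*,r}` and every oracle with average-case
success `≥ 2/3` on `LWE_{q,Ψ̄_α}` from `m` samples,

  `Pr[regevBDD = some z with B z the closest vector] ≥
      1 - (K_g+1)J(m+N_V)(δ + 6·2⁻ⁿ) - (K_g+1)J·η_A - 2^{-J}`

for any verification test with error bounds `(η_A, η_R ≤ 1/7)` (`…_of_admissible_cos`: Regev's cosine
test, `η_A = e^{-N_V e^{-2πα²}/32}`), and `coeffVec B z = z ᵥ* B ∈ ℤⁿ` is then a `CVP` solution with
factor `1` (`isSolution_coeffVec_repr`) —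
the event `bddSuccess` of `PeikertReduction.lean` read before coding. What remains for `h₂` is the
machine realising `regevBDD` (GPV sampler for `D`, whose law-level guarantee is the tree's
`tvDist_sampleLatticePMF_discreteGaussian_le`; noise sampling; exact arithmetic; oracle I/O) and the
parameter schedule (`m = m(n)`, `K_g = 24m`, `J = N_V = poly(n)`, `K` with `qK ≥ 4πe^{π}`) making the
bound `≤ n^{-c}`.

## References

* C. Peikert, *Public-key cryptosystems from the worst-case shortest vector problem*, STOC 2009,
  Prop. 3.2, Prop. 2.8, Lemma 2.3 and the proof of Thm. 3.1 (full version pp. 8–12) [Peikert2009].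
* O. Regev, *On lattices, learning with errors, random linear codes, and cryptography*, J. ACM 56
  (2009), art. 34, Lemma 3.4 (= §3.2.1) [RegevLWE2009].
-/

noncomputable section

open Finset Module MeasureTheory Metric
open scoped ENNReal Real InnerProductSpace

namespace Literature.Computability.Cryptography

namespace Peikert2009

open Literature.Probability.Distributions Literature.Algebra.EuclideanLattices
  Literature.Algebra.EuclideanLattices.LatticeInstance Regev2009 LWE

/-! ### The two dual `ℤ`-bases of a nonsingular instance -/

section Bases

variable (I : LatticeInstance) [hZ : IsZLattice ℝ I.lattice]

/-- A full-rank instance is nonsingular. [folklore] -/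
theorem isNonsingular_of_isZLattice : I.IsNonsingular := I.isNonsingular_iff_isZLattice.2 hZ

/-- LOCAL GLUE. The rows `b₁, …, bₙ` of a nonsingular `B ∈ ℤⁿˣⁿ` as a `ℤ`-basis of `L(B)`. [cite: Peikert2009, §2.1 (full version: "a lattice … generated as all integer combinations of a basis")] -/
def zBasis : Basis (Fin I.n) ℤ I.lattice :=
  ((basisOfIsNonsingular (isNonsingular_of_isZLattice I)).restrictScalars ℤ).map
    (LinearEquiv.ofEq _ _ (lattice_eq_span_basisOfIsNonsingular (isNonsingular_of_isZLattice I)).symm)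

/-- `zBasis i = bᵢ`. [folklore] -/
@[simp] theorem coe_zBasis (i : Fin I.n) : ((zBasis I i : I.lattice) : EuclideanSpace ℝ (Fin I.n)) = I.vec i := by
  simp [zBasis]

/-- The real basis attached to `zBasis` is the basis of rows. [folklore] -/
theorem ofZLatticeBasis_zBasis :
    (zBasis I).ofZLatticeBasis ℝ I.lattice = basisOfIsNonsingular (isNonsingular_of_isZLattice I) :=
  Basis.eq_of_apply_eq fun i => by
    rw [Basis.ofZLatticeBasis_apply, coe_zBasis, coe_basisOfIsNonsingular]

/-- LOCAL GLUE. The dual basis `B^∨` of `ℝⁿ` (`⟪bᵢ, b^∨ⱼ⟫ = δᵢⱼ`; Peikert's `D = B^{-t}`). [cite: Peikert2009, §2.1 (full version p. 7: "the dual basis `D`")] -/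
def dualVec : Basis (Fin I.n) ℝ (EuclideanSpace ℝ (Fin I.n)) :=
  LinearMap.BilinForm.dualBasis (innerₗ (EuclideanSpace ℝ (Fin I.n)) :
    LinearMap.BilinForm ℝ (EuclideanSpace ℝ (Fin I.n))) innerₗ_nondegenerate
    (basisOfIsNonsingular (isNonsingular_of_isZLattice I))

/-- `L(B)* = span_ℤ(B^∨)`. [cite: Peikert2009, §2.1 (full version p. 7: "`D` is a basis of `Λ*`")] -/
theorem dualLattice_eq_span_dualVec : dualLattice I.lattice = Submodule.span ℤ (Set.range (dualVec I)) := by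
  rw [dualLattice_eq_span_dualBasis I.lattice (zBasis I), ofZLatticeBasis_zBasis]
  rfl

/-- LOCAL GLUE. The dual basis as a `ℤ`-basis of the dual lattice `L(B)*`. [cite: Peikert2009, §2.1 (full version p. 7)] -/
def dualZBasis : Basis (Fin I.n) ℤ (dualLattice I.lattice) :=
  ((dualVec I).restrictScalars ℤ).map (LinearEquiv.ofEq _ _ (dualLattice_eq_span_dualVec I).symm)

/-- `dualZBasis j = b^∨ⱼ`. [folklore] -/
@[simp] theorem coe_dualZBasis (j : Fin I.n) :
    ((dualZBasis I j : dualLattice I.lattice) : EuclideanSpace ℝ (Fin I.n)) = dualVec I j := by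
  simp [dualZBasis]

/-- **Biorthogonality**: `⟪bᵢ, b^∨ⱼ⟫ = δᵢⱼ`. [cite: Peikert2009, §2.1 (full version p. 7)] -/
theorem inner_zBasis_dualZBasis (i j : Fin I.n) :
    ⟪((zBasis I i : I.lattice) : EuclideanSpace ℝ (Fin I.n)),
      ((dualZBasis I j : dualLattice I.lattice) : EuclideanSpace ℝ (Fin I.n))⟫_ℝ = if i = j then 1 else 0 := by
  rw [coe_zBasis, coe_dualZBasis, dualVec, ← coe_basisOfIsNonsingular (isNonsingular_of_isZLattice I),
    ← innerₗ_apply_apply, LinearMap.BilinForm.apply_dualBasis_right _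
      (LinearMap.BilinForm.isSymm_iff.mpr isSymm_inner)]

/-- LOCAL GLUE. The integer vector `z ᵥ* B = ∑ᵢ zᵢbᵢ ∈ ℤⁿ` of the lattice point with
`B`-coordinates `z` (what a `BDD`/`CVP` solver outputs). [folklore] -/
def coeffVec (z : Fin I.n → ℤ) : Fin I.n → ℤ := Matrix.vecMul z I.basis

omit hZ in
/-- `coeffVec z` viewed in `ℝⁿ` is `∑ zᵢbᵢ`. [folklore] -/
theorem intVecToEuclidean_coeffVec (z : Fin I.n → ℤ) : intVecToEuclidean I.n (coeffVec I z) = I.ofCoeffs z := rfl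

/-- `∑ (B⁻¹κ)ᵢ bᵢ = κ`. [folklore] -/
theorem ofCoeffs_repr (κ : I.lattice) :
    I.ofCoeffs (fun i => (zBasis I).repr κ i) = (κ : EuclideanSpace ℝ (Fin I.n)) := by
  conv_rhs => rw [← (zBasis I).sum_repr κ]
  rw [ofCoeffs_eq_sum, Submodule.coe_sum]
  refine sum_congr rfl fun i _ => ?_
  rw [Submodule.coe_smul_of_tower, coe_zBasis]

end Bases

/-! ### A closest vector, and the `CVP` solution it codes -/

/-- **A closest lattice vector exists** (the lattice is closed and nonempty in the proper space
`ℝⁿ`). [folklore] -/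
theorem exists_closest (I : LatticeInstance) (x : EuclideanSpace ℝ (Fin I.n)) :
    ∃ κ : I.lattice, dist x κ = infDist x I.lattice := by
  have hclosed : IsClosed (X := EuclideanSpace ℝ (Fin I.n)) I.lattice :=
    @AddSubgroup.isClosed_of_discrete _ _ _ _ _ I.lattice.toAddSubgroup
      (inferInstanceAs (DiscreteTopology I.lattice))
  obtain ⟨v, hv, hvd⟩ := hclosed.exists_infDist_eq_dist ⟨0, I.lattice.zero_mem⟩ x
  exact ⟨⟨v, hv⟩, hvd.symm⟩

/-- **A closest vector is a `CVP` solution with factor `1`** (the success event `bddSuccess` of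
`PeikertReduction.lean`, before coding). [cite: Peikert2009, Prop. 3.2 (full version p. 11: "the unique `v ∈ Λ` closest to `x`")] -/
theorem isSolution_coeffVec_repr (c : CVPInstance) [IsZLattice ℝ c.I.lattice] (κ : c.I.lattice)
    (hκ : dist c.targetE κ = infDist c.targetE c.I.lattice) :
    CVP.IsSolution (fun _ => 1) c (coeffVec c.I fun i => (zBasis c.I).repr κ i) := by
  refine ⟨?_, ?_⟩
  · rw [intVecToEuclidean_coeffVec, ofCoeffs_repr]; exact κ.2
  · rw [intVecToEuclidean_coeffVec, ofCoeffs_repr, one_mul, dist_comm, hκ]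

/-! ### Admissible inputs satisfy the hypotheses of the idealised reduction -/

section Admissible

variable {q : ℕ → ℕ} [∀ n, NeZero (q n)] {α f : ℕ → ℝ}

/-- The Gram–Schmidt vectors of a nonsingular basis are nonzero. [folklore] -/
theorem gramSchmidt_zBasis_ne_zero (I : LatticeInstance) [IsZLattice ℝ I.lattice] (i : Fin I.n) :
    InnerProductSpace.gramSchmidt ℝ (fun i => ((zBasis I i : I.lattice) : EuclideanSpace ℝ (Fin I.n))) i ≠ 0 := by
  have h : (fun i => ((zBasis I i : I.lattice) : EuclideanSpace ℝ (Fin I.n))) = I.vec := funext (coe_zBasis I)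
  rw [h]
  exact InnerProductSpace.gramSchmidt_ne_zero i (linearIndependent_vec (isNonsingular_of_isZLattice I))

/-- **Peikert 2009, Prop. 3.2 on an `f`-admissible input — the success bound of the idealised
reduction.** Let `p = ((B, x), r)` be `f`-admissible for `(q, α)` at dimension `n = p.1.I.n ≥ 1`
(`BDDAdmissible q α f p`), with `0 < α(n)` and `√2·α(n) < f(n)√(log n)` (eventually true as `f → ∞`).
Then for every sampler `D` of `L(B)*` with `Δ(D, D_{L(B)*,r}) ≤ δ`, every oracle `F` with average-case
success `≥ 2/3` on `LWE_{q(n),Ψ̄_{α(n)}}` from `m` samples, every verification test `Acc` with error bounds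
`(η_A, η_R ≤ 1/7)` under the fine laws `A^{(K)}_{s',Ψ̄_{β'}}` (`0 < β' ≤ α(n)`), and parameters
`K_g ≥ max(1, 24m)`, there is a closest vector `κ` (coding a `CVP` solution with factor `1`,
`isSolution_coeffVec_repr`) such that
`Pr[regevBDD ≠ some (B⁻¹κ)] ≤ (K_g+1)J(m+N_V)(δ + 6·2⁻ⁿ) + (K_g+1)J·η_A + 2^{-J}`.
[cite: Peikert2009, Prop. 3.2 with Prop. 2.8 and the proof of Thm. 3.1 (full version pp. 11–12); RegevLWE2009, Lemma 3.4] -/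
theorem toReal_regevBDD_ne_le_of_admissible (p : GapCVPInstance) [IsZLattice ℝ p.1.I.lattice]
    (hadm : BDDAdmissible q α f p) (hn : 1 ≤ p.1.I.n) (hα : 0 < α p.1.I.n)
    (hgap : Real.sqrt 2 * α p.1.I.n < f p.1.I.n * Real.sqrt (Real.log p.1.I.n))
    (D : PMF (dualLattice p.1.I.lattice)) {δ : ℝ}
    (hD : D.tvDist (discreteGaussian (dualLattice p.1.I.lattice) p.2 0) ≤ δ) (K m NV Kg J : ℕ) [NeZero K]
    (F : (Fin m → (Fin p.1.I.n → ZMod (q p.1.I.n)) × ZMod (q p.1.I.n)) → Fin p.1.I.n → ZMod (q p.1.I.n))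
    (hF : ENNReal.ofReal (2 / 3) ≤
      searchSuccessProb (discretizedGaussian (q p.1.I.n) (α p.1.I.n)) m fun B => PMF.pure (F B))
    (hKg : 24 * m ≤ Kg) (hKg1 : 1 ≤ Kg)
    (Acc : (Fin p.1.I.n → ZMod (q p.1.I.n)) → Set (Fin NV → (Fin p.1.I.n → ZMod (q p.1.I.n)) × ZMod (q p.1.I.n * K)))
    {ηA ηR : ℝ} (hηA : 0 ≤ ηA)
    (hAcc : ∀ β' : ℝ, 0 < β' → β' ≤ α p.1.I.n → ∀ s' : Fin p.1.I.n → ZMod (q p.1.I.n),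
      (∀ c, c ≠ s' → ((iidPMF (lweSampleK (q p.1.I.n) K (discretizedGaussian (q p.1.I.n * K) β') s') NV).toOuterMeasure
        (Acc c)).toReal ≤ ηA) ∧
      ((iidPMF (lweSampleK (q p.1.I.n) K (discretizedGaussian (q p.1.I.n * K) β') s') NV).toOuterMeasure
        (Acc s')ᶜ).toReal ≤ ηR)
    (hηR7 : ηR ≤ 1 / 7) :
    ∃ κ : p.1.I.lattice, dist p.1.targetE κ = infDist p.1.targetE p.1.I.lattice ∧
      ((regevBDD (zBasis p.1.I) (dualZBasis p.1.I) (q p.1.I.n) K m NV Kg J D p.1.targetE (α p.1.I.n) F Acc).toOuterMeasure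
          {o | o ≠ some (fun i => (zBasis p.1.I).repr κ i)}).toReal ≤
        ((Kg + 1) * J : ℕ) * ((m + NV) * (δ + 6 * (2⁻¹ : ℝ) ^ p.1.I.n)) + (((Kg + 1) * J : ℕ) * ηA + (1 / 2) ^ J) := by
  obtain ⟨-, hr0, hGSr, hη, hdist⟩ := hadm
  obtain ⟨κ, hκ⟩ := exists_closest p.1.I p.1.targetE
  refine ⟨κ, hκ, ?_⟩
  have hr : (0 : ℝ) < p.2 := by exact_mod_cast hr0
  have hq : (0 : ℝ) < q p.1.I.n := Nat.cast_pos.2 (Nat.pos_of_ne_zero (NeZero.ne (q p.1.I.n)))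
  have hs2 : (0 : ℝ) < Real.sqrt 2 := Real.sqrt_pos.2 two_pos
  -- `ε = 2⁻ⁿ`
  have hε : (0 : ℝ) < (2⁻¹ : ℝ) ^ p.1.I.n := by positivity
  have hε' : (2⁻¹ : ℝ) ^ p.1.I.n ≤ 1 / 2 := by
    calc (2⁻¹ : ℝ) ^ p.1.I.n ≤ (2⁻¹ : ℝ) ^ 1 := pow_le_pow_of_le_one (by norm_num) (by norm_num) hn
      _ = 1 / 2 := by norm_num
  -- the distance hypothesis `r‖x - κ‖ ≤ (α/√2) q`
  have hxκ : ‖p.1.targetE - (κ : EuclideanSpace ℝ (Fin p.1.I.n))‖ = infDist p.1.targetE p.1.I.lattice := by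
    rw [← dist_eq_norm]; exact hκ
  have hx : (p.2 : ℝ) * ‖p.1.targetE - (κ : EuclideanSpace ℝ (Fin p.1.I.n))‖ ≤
      α p.1.I.n / Real.sqrt 2 * q p.1.I.n := by
    rw [hxκ]
    calc (p.2 : ℝ) * infDist p.1.targetE p.1.I.lattice
        ≤ p.2 * (α p.1.I.n * q p.1.I.n / (Real.sqrt 2 * p.2)) := mul_le_mul_of_nonneg_left hdist hr.le
      _ = α p.1.I.n / Real.sqrt 2 * q p.1.I.n := by field_simp
  -- the one-digit Babai condition
  have hxB : ∀ i, ‖p.1.targetE - (κ : EuclideanSpace ℝ (Fin p.1.I.n))‖ / q p.1.I.n <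
      ‖InnerProductSpace.gramSchmidt ℝ
        (fun i => ((zBasis p.1.I i : p.1.I.lattice) : EuclideanSpace ℝ (Fin p.1.I.n))) i‖ / 2 := by
    intro i
    have hfun : (fun i => ((zBasis p.1.I i : p.1.I.lattice) : EuclideanSpace ℝ (Fin p.1.I.n))) = p.1.I.vec :=
      funext (coe_zBasis p.1.I)
    rw [hfun]
    have hGS := hGSr i
    -- `‖x - κ‖/q ≤ α/(√2 r)` and `f√(log n)/r ≤ ‖b̃ᵢ‖`, with `√2 α < f √(log n)`
    have h1 : ‖p.1.targetE - (κ : EuclideanSpace ℝ (Fin p.1.I.n))‖ / q p.1.I.n ≤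
        α p.1.I.n / (Real.sqrt 2 * p.2) := by
      rw [div_le_iff₀ hq, hxκ]
      calc infDist p.1.targetE p.1.I.lattice ≤ α p.1.I.n * q p.1.I.n / (Real.sqrt 2 * p.2) := hdist
        _ = α p.1.I.n / (Real.sqrt 2 * p.2) * q p.1.I.n := by ring
    have h2 : α p.1.I.n / (Real.sqrt 2 * p.2) < ‖InnerProductSpace.gramSchmidt ℝ p.1.I.vec i‖ / 2 := by
      rw [div_lt_div_iff₀ (by positivity) two_pos]
      have h3 : f p.1.I.n * Real.sqrt (Real.log p.1.I.n) * Real.sqrt 2 ≤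
          p.2 * ‖InnerProductSpace.gramSchmidt ℝ p.1.I.vec i‖ * Real.sqrt 2 :=
        mul_le_mul_of_nonneg_right hGS hs2.le
      have h4 : Real.sqrt 2 * Real.sqrt 2 = 2 := Real.mul_self_sqrt zero_le_two
      nlinarith [h3, hgap, h4, hr, hs2]
    exact h1.trans_lt h2
  exact toReal_regevBDD_ne_le (zBasis p.1.I) (dualZBasis p.1.I) (q p.1.I.n) K m NV Kg J
    (inner_zBasis_dualZBasis p.1.I) D hD hε hε' hr hα hη p.1.targetE κ hx
    (gramSchmidt_zBasis_ne_zero p.1.I) hxB F hF hKg hKg1 Acc hηA hAcc hηR7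

/-- **The instance with Regev's cosine test** (`Acc = acceptSet q K N_V θ_α`; `4πe^{πα²} ≤ qK`,
`e^{-N_V e^{-2πα²}/128} ≤ 1/7`; `η_A = e^{-N_V e^{-2πα²}/32}`).
[cite: Peikert2009, Prop. 3.2; RegevLWE2009, Lemma 3.4 with Lemma 3.6] -/
theorem toReal_regevBDD_ne_le_of_admissible_cos (p : GapCVPInstance) [IsZLattice ℝ p.1.I.lattice]
    (hadm : BDDAdmissible q α f p) (hn : 1 ≤ p.1.I.n) (hα : 0 < α p.1.I.n)
    (hgap : Real.sqrt 2 * α p.1.I.n < f p.1.I.n * Real.sqrt (Real.log p.1.I.n))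
    (D : PMF (dualLattice p.1.I.lattice)) {δ : ℝ}
    (hD : D.tvDist (discreteGaussian (dualLattice p.1.I.lattice) p.2 0) ≤ δ) (K m NV Kg J : ℕ) [NeZero K]
    (F : (Fin m → (Fin p.1.I.n → ZMod (q p.1.I.n)) × ZMod (q p.1.I.n)) → Fin p.1.I.n → ZMod (q p.1.I.n))
    (hF : ENNReal.ofReal (2 / 3) ≤
      searchSuccessProb (discretizedGaussian (q p.1.I.n) (α p.1.I.n)) m fun B => PMF.pure (F B))
    (hKg : 24 * m ≤ Kg) (hKg1 : 1 ≤ Kg)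
    (hqK : 4 * π * Real.exp (π * α p.1.I.n ^ 2) ≤ (q p.1.I.n * K : ℕ))
    (hNV : Real.exp (-(NV * Real.exp (-(2 * π * α p.1.I.n ^ 2)) / 128)) ≤ 1 / 7) :
    ∃ κ : p.1.I.lattice, dist p.1.targetE κ = infDist p.1.targetE p.1.I.lattice ∧
      ((regevBDD (zBasis p.1.I) (dualZBasis p.1.I) (q p.1.I.n) K m NV Kg J D p.1.targetE (α p.1.I.n) F
            (acceptSet (q p.1.I.n) K NV (threshold (α p.1.I.n)))).toOuterMeasure
          {o | o ≠ some (fun i => (zBasis p.1.I).repr κ i)}).toReal ≤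
        ((Kg + 1) * J : ℕ) * ((m + NV) * (δ + 6 * (2⁻¹ : ℝ) ^ p.1.I.n)) +
          (((Kg + 1) * J : ℕ) * Real.exp (-(NV * Real.exp (-(2 * π * α p.1.I.n ^ 2)) / 32)) + (1 / 2) ^ J) :=
  toReal_regevBDD_ne_le_of_admissible p hadm hn hα hgap D hD K m NV Kg J F hF hKg hKg1 _ (Real.exp_pos _).le
    (fun β' hβ' hβ'α s' =>
      ⟨fun c hc => toReal_accept_of_ne_le_exp (q p.1.I.n) K (α p.1.I.n) β' hc NV,
       toReal_reject_self_le_exp (q p.1.I.n) K (by rw [abs_of_pos hβ']; exact hβ'α) hqK s' NV⟩) hNV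

end Admissible

end Peikert2009

end Literature.Computability.Cryptography
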